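import Literature.NumberTheory.NumberFields.NarrowClassGroupTwoRankQuadraticGenus
import Literature.NumberTheory.IwasawaTheory.NarrowRankJumpLayerOne
import Literature.NumberTheory.IwasawaTheory.NarrowClassNumberOnePrimeTower
import Literature.NumberTheory.IwasawaTheory.ZpExtensionNormKernelLayerPair
import HarnessLib

/-!
# Narrow genus theory IN THE TOWER: `rank₂ Cl⁺(K_{m+1}) = t_m − 1` whenever `h⁺(K_m)` is odd (`t_m` = number of primes of `K_m` ramified in `K_{m+1}`),
# for the layers of a `ℤ₂`-extension of a totally real field — the exact layer-currency form of the rung `m` of the narrow rank certificate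

Topic `NumberTheory/IwasawaTheory`; namespace `Literature.NumberTheory.IwasawaTheory` (that of `NarrowFukudaCertificateLayerModels.lean` /
`NarrowRankJumpLayerOne.lean`).  THEOREM-ONLY file (no definition, no named fact, no instance, no `sorry`), written by the prover seat
`cruxlead-stmt-BirchSwinnertonDyer-19573-w2` GEN 12 (cell `bsd-2adic`; `--supports` stmt-BirchSwinnertonDyer-19573; closes nothing).  The layer currency of
`AmbiguousClass.index_range_pow_two_narrowClassGroup_mul_two_eq` (`NarrowClassGroupTwoRankQuadraticGenus.lean`: `L/K` totally real quadratic, `h⁺(K)` odd ⟹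
`[Cl⁺(L) : Cl⁺(L)²] · 2 = ∏_𝔭 e_𝔭 = 2^t`), refining k4-w2's parity statement `index_range_pow_two_narrowClassGroup_layer_one_ne_layer_zero`
(`NarrowRankJumpLayerOne.lean`) to an EXACT value.

* ★ `index_range_pow_two_narrowClassGroup_layer_succ_mul_two_eq` — `K` totally real, `κ` any `ℤ₂`-extension of `K`, layers `K_m ⊆ K_{m+1}` with a compatible
  algebra structure (`[Algebra (κ.layer m) (κ.layer (m+1))] [IsScalarTower K _ _]`, as in `ZpExtensionNormKernelLayerPair.lean` § Degrees), `h⁺(K_m)` odd: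
  **`[Cl⁺(K_{m+1}) : Cl⁺(K_{m+1})²] · 2 = ∏_𝔓 e_𝔓(K_{m+1}/K_m)`** (`= 2^{t_m}`, `…_eq_two_pow`) — so the rung `m` of the narrow rank certificate
  (`rank₂ Cl⁺(K_{m+1}) = rank₂ Cl⁺(K_m) = 0`) holds iff exactly ONE prime of `K_m` ramifies in `K_{m+1}`, and otherwise the rank jumps to EXACTLY `t_m − 1`.
* `index_range_pow_two_narrowClassGroup_layer_one_mul_two_eq` — the rung-`0` reading with a concrete model: `K` totally real of odd degree, `h⁺(K)` odd, `κ`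
  cyclotomic, `L ⊇ K` Galois quadratic totally real with `θ² = 2` (a model of `K_1 = K(√2)`): `[Cl⁺(K_1) : Cl⁺(K_1)²] · 2 = ∏_𝔭 e_𝔭(L/K)`.

References: [Gras2003] IV.4; [FrohlichTaylor1990] Ch. V §2; [Fukuda1994] Thm. 1 (2), p. 264 (the rank certificate); [Washington1997] §13.1 (layers of the
cyclotomic `ℤ₂`-extension, `K_1 = K(√2)`).
-/

noncomputable section

open scoped NumberField
open NumberField Field IsDedekindDomain

namespace Literature.NumberTheory.IwasawaTheory

open Literature.NumberTheory.EllipticCurves Literature.NumberTheory.NumberFields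
  Literature.NumberTheory.NumberFields.AmbiguousClass

variable {K : Type} [Field K] [NumberField K]

/-- ★ **`rank₂ Cl⁺(K_{m+1}) = t_m − 1` when `h⁺(K_m)` is odd**, in the form `[Cl⁺(K_{m+1}) : Cl⁺(K_{m+1})²] · 2 = ∏_𝔓 e_𝔓(K_{m+1}/K_m)`: `K` totally real,
`κ` a `ℤ₂`-extension of `K`, consecutive layers `K_m ⊆ K_{m+1}` (compatible algebra structure), `h⁺(K_m)` odd.  The layers are totally real
(`isTotallyReal_layer`), `K_{m+1}/K_m` is Galois of degree `2` (`isGalois_layer_layer`, `finrank_layer_layer`), and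
`AmbiguousClass.index_range_pow_two_narrowClassGroup_mul_two_eq` applies. [cite: Fukuda1994, Thm. 1 (2), p. 264] [cite: Gras2003, IV.4]
[cite: FrohlichTaylor1990, Ch. V §2] -/
theorem index_range_pow_two_narrowClassGroup_layer_succ_mul_two_eq [IsTotallyReal K] (κ : ZpExtension K 2) (m : ℕ)
    [NumberField (κ.layer m)] [NumberField (κ.layer (m + 1))]
    [Algebra (κ.layer m) (κ.layer (m + 1))] [IsScalarTower K (κ.layer m) (κ.layer (m + 1))]
    (hodd : Odd (narrowClassNumber (κ.layer m))) :
    (powMonoidHom (α := NarrowClassGroup (κ.layer (m + 1))) 2).range.index * 2 =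
      ∏ᶠ v : HeightOneSpectrum (𝓞 (κ.layer m)), v.asIdeal.ramificationIdxIn (𝓞 (κ.layer (m + 1))) := by
  haveI : Fact (Nat.Prime 2) := ⟨Nat.prime_two⟩
  haveI : IsTotallyReal (κ.layer (m + 1)) := isTotallyReal_layer κ (m + 1)
  haveI : IsGalois (κ.layer m) (κ.layer (m + 1)) := isGalois_layer_layer κ
  have h2 : Module.finrank (κ.layer m) (κ.layer (m + 1)) = 2 := by
    rw [finrank_layer_layer κ (Nat.le_succ m), Nat.succ_sub (le_refl m), Nat.sub_self, pow_one]
  obtain ⟨σ, -, -, hσ⟩ := exists_algEquiv_ne_one_of_finrank_eq_two (K := κ.layer m) (L := κ.layer (m + 1)) h2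
  exact index_range_pow_two_narrowClassGroup_mul_two_eq hσ h2 hodd

/-- The same with the ramified primes counted: **`[Cl⁺(K_{m+1}) : Cl⁺(K_{m+1})²] · 2 = 2^{t_m}`**, `t_m = #{𝔓 ⊂ 𝓞_{K_m} : e_𝔓(K_{m+1}/K_m) ≠ 1}`.
[cite: Fukuda1994, Thm. 1 (2), p. 264] [cite: Gras2003, IV.4] -/
theorem index_range_pow_two_narrowClassGroup_layer_succ_mul_two_eq_two_pow [IsTotallyReal K] (κ : ZpExtension K 2) (m : ℕ)
    [NumberField (κ.layer m)] [NumberField (κ.layer (m + 1))]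
    [Algebra (κ.layer m) (κ.layer (m + 1))] [IsScalarTower K (κ.layer m) (κ.layer (m + 1))]
    (hodd : Odd (narrowClassNumber (κ.layer m))) :
    (powMonoidHom (α := NarrowClassGroup (κ.layer (m + 1))) 2).range.index * 2 =
      2 ^ {v : HeightOneSpectrum (𝓞 (κ.layer m)) | v.asIdeal.ramificationIdxIn (𝓞 (κ.layer (m + 1))) ≠ 1}.ncard := by
  haveI : Fact (Nat.Prime 2) := ⟨Nat.prime_two⟩
  haveI : IsGalois (κ.layer m) (κ.layer (m + 1)) := isGalois_layer_layer κ
  have h2 : Module.finrank (κ.layer m) (κ.layer (m + 1)) = 2 := by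
    rw [finrank_layer_layer κ (Nat.le_succ m), Nat.succ_sub (le_refl m), Nat.sub_self, pow_one]
  rw [index_range_pow_two_narrowClassGroup_layer_succ_mul_two_eq κ m hodd, finprod_ramificationIdxIn_eq_pow_of_prime Nat.prime_two h2]

/-- **Rung `0` with a concrete model: `[Cl⁺(K_1) : Cl⁺(K_1)²] · 2 = ∏_𝔭 e_𝔭(L/K)`** for `K` totally real of odd degree with `h⁺(K)` odd, `κ` a cyclotomic
`ℤ₂`-extension, `L ⊇ K` Galois of degree `2`, totally real, with `θ² = 2` (a model of `K_1 = K(√2)`; narrow-rank transport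
`index_range_pow_narrowClassGroup_layer_one_eq`) — the EXACT form of k4-w2's `index_range_pow_two_narrowClassGroup_layer_one_ne_layer_zero`: with `t` primes
of `K` ramified in `L`, `rank₂ Cl⁺(K_1) = t − 1` while `rank₂ Cl⁺(K_0) = 0`. [cite: Fukuda1994, Thm. 1 (2), p. 264] [cite: Gras2003, IV.4] [cite: Washington1997, §13.1] -/
theorem index_range_pow_two_narrowClassGroup_layer_one_mul_two_eq [IsTotallyReal K] (hdeg : Odd (Module.finrank ℚ K))
    (κ : ZpExtension K 2) (hκ : κ.IsCyclotomic)
    (L : Type) [Field L] [NumberField L] [Algebra K L] [IsGalois K L] [IsTotallyReal L] (hL : Module.finrank K L = 2)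
    (θ : L) (hθ : θ ^ 2 = 2) (hK : Odd (narrowClassNumber K)) [NumberField (κ.layer 1)] :
    (powMonoidHom (α := NarrowClassGroup (κ.layer 1)) 2).range.index * 2 =
      ∏ᶠ v : HeightOneSpectrum (𝓞 K), v.asIdeal.ramificationIdxIn (𝓞 L) := by
  haveI : Fact (Nat.Prime 2) := ⟨Nat.prime_two⟩
  obtain ⟨σ, -, -, hσ⟩ := exists_algEquiv_ne_one_of_finrank_eq_two (K := K) (L := L) hL
  rw [index_range_pow_narrowClassGroup_layer_one_eq hdeg κ hκ L hL θ hθ 2]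
  exact index_range_pow_two_narrowClassGroup_mul_two_eq hσ hL hK

/-- With the ramified primes counted: **`[Cl⁺(K_1) : Cl⁺(K_1)²] · 2 = 2^t`**, `t = #{𝔭 : e_𝔭(L/K) ≠ 1}` for any model `L` of `K(√2)` as above.
[cite: Fukuda1994, Thm. 1 (2), p. 264] [cite: Gras2003, IV.4] -/
theorem index_range_pow_two_narrowClassGroup_layer_one_mul_two_eq_two_pow [IsTotallyReal K] (hdeg : Odd (Module.finrank ℚ K))
    (κ : ZpExtension K 2) (hκ : κ.IsCyclotomic)
    (L : Type) [Field L] [NumberField L] [Algebra K L] [IsGalois K L] [IsTotallyReal L] (hL : Module.finrank K L = 2)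
    (θ : L) (hθ : θ ^ 2 = 2) (hK : Odd (narrowClassNumber K)) [NumberField (κ.layer 1)] :
    (powMonoidHom (α := NarrowClassGroup (κ.layer 1)) 2).range.index * 2 =
      2 ^ {v : HeightOneSpectrum (𝓞 K) | v.asIdeal.ramificationIdxIn (𝓞 L) ≠ 1}.ncard := by
  rw [index_range_pow_two_narrowClassGroup_layer_one_mul_two_eq hdeg κ hκ L hL θ hθ hK,
    finprod_ramificationIdxIn_eq_pow_of_prime Nat.prime_two hL]

end Literature.NumberTheory.IwasawaTheory

end
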